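import Literature.NumberTheory.NumberFields.UnramifiedElementaryCoinvariantModP
import Literature.NumberTheory.NumberFields.HilbertClassFieldCentralModP
import Literature.NumberTheory.NumberFields.HilbertClassFieldMaximal
import Literature.NumberTheory.NumberFields.InertiaGeneratesGalois
import HarnessLib

/-!
# GENUS COINVARIANTS ARE READ AT THE FIRST LAYER: for `L/K` cyclic of `p`-power degree in which every ramified prime is TOTALLY
# ramified, the order of the `Gal(L/K)`-coinvariants of `Cl(L)/p` is at most that of the `Gal(K₁/K)`-coinvariants of `Cl(K₁)/p`,
# `K₁` the layer of degree `p` — `[Cl(L) : Cl(L)^p·⟨σc·c⁻¹⟩] ≤ [Cl(K₁) : Cl(K₁)^p·⟨σc·c⁻¹⟩]`, ANY number of ramified primes, ANY `h_K`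

Topic `NumberTheory/NumberFields` (namespace = path).  THEOREM-ONLY file (no definition, no named fact, no instance, no `sorry`), written by the
prover seat `bsd-line-att-p3` g53 (cell `bsd-f1-sign2`, route `AlignedTransportAtTwo`; `--supports` stmt-BirchSwinnertonDyer-22298, closes nothing).
Sequel of this lineage's `GenusCoinvariantCyclicOfTwoRamified.lean` (g49: `p ∤ h_K`, at most TWO ramified primes ⟹ coinvariants cyclic).  Here the number of
ramified primes and the class number of `K` are arbitrary; the price is that every ramified prime must be totally ramified (the layers `K_n/K` of a `ℤ_p`-extension
with Fukuda index `0`), and the output is a COMPARISON with the first layer instead of an absolute bound.  In Iwasawa's language ([Washington1997] §13.3,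
Lemmas 13.15 and 13.18): with total ramification from layer `0`, `A_n ≅ X/ν_n Y₀` and `ν_n ∈ (p, T) = 𝔪` for `n ≥ 1`, so `A_n/𝔪A_n ≅ X/(𝔪X + Y₀… ) = A_1/𝔪A_1` — the
number of `Λ`-generators seen by the coinvariants is the same at every layer `n ≥ 1`.  This file proves the finite-level inequality `#(A_n/𝔪A_n) ≤ #(A_1/𝔪A_1)` by class
field theory, with no `Λ`-modules.

THE THEOREM (`index_pow_sup_closure_le_of_layer_one`).  `L/K` Galois with CYCLIC group, unramified at the infinite places; `M` an intermediate field, Galois of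
degree `p` over `K`; a maximal ideal `P₁ ⊂ 𝓞_K` above which every prime of `𝓞_L` has ramification index `[L:K]`; and EVERY maximal ideal of `𝓞_L` has ramification
index `1` or `[L:K]` over `K`.  THEN **`[Cl(𝓞 L) : Cl^p·⟨σc·c⁻¹ : σ ∈ Gal(L/K)⟩] ≤ [Cl(𝓞 M) : Cl^p·⟨σc·c⁻¹ : σ ∈ Gal(M/K)⟩]`**.
PROOF.  In `Γ = Gal(H/K)`, `H` the Hilbert class field of `L`, let `A = Gal(H/L) ≅ Cl(L)`, `C = Artin(Cl^p⟨σc c⁻¹⟩)`, `Γ₁ = Gal(H/M)` (index `p`), `I₁` the inertia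
group of a prime above `P₁` (`I₁ ∩ A = 1`, `#I₁ = [Γ:A]`, so `Γ = A·I₁`), and `P = C·⟨g^p : g ∈ Γ⟩`.  (1) Equivariance of the Artin map gives `⁅Γ, A⁆ ≤ C`, hence `⁅Γ,Γ⁆ ≤ C`
(`Γ/A` cyclic) — g49 verbatim.  (2) GROUP LEMMA (`relIndex_le_relIndex_of_genus_layer_data`): with `B = C·(I₁ ∩ Γ₁)` one has `P ≤ B` (`(a i)^p ≡ a^p i^p`, `a^p ∈ C`,
`i^p ∈ I₁ ∩ Γ₁`) and `B ∩ A = C` (`I₁ ∩ A = 1`), so `[A : C] = [A : A ∩ B] ≤ [Γ₁ : B] ≤ [Γ₁ : P]`.  (3) `[Γ₁ : P] ∣ [Cl(M) : Cl^p⟨σc c⁻¹⟩]` is the tree's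
`index_sup_pow_sup_comap_commutator_dvd` (k9-c4, `UnramifiedElementaryCoinvariantModP`) for `K ⊆ M ⊆ H` with `N = P ∩ Γ₁`: `N ⊇ Γ₁'`, and `N` contains every inertia group
of `H/M` because an inertia group `I` of `H/K` is cyclic, either trivial or of order `[Γ:A]` (then `Γ = A·I`, so `I ⊄ Γ₁` and `I ∩ Γ₁ ⊆ ⟨g^p⟩`).  Hence
`[Cl(L) : …] = [A:C] ≤ [Γ₁:P] ≤ [Cl(M) : …]`.

HONEST SCOPE: classical genus theory at finite level; nothing specific to any summit; no certificate for any field is asserted; BSD is not advanced by this file.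
Not found in print in this finite form (corpus hybrid/vsearch «number of generators of the Iwasawa module read at the first layer», «genus theory along a
totally ramified cyclic p-extension»; galaxy all «genus field|ambiguous class|totally ramified»): it is [Washington1997] Lemma 13.15/13.18 read modulo `𝔪`, assembled
from cited ingredients (D-0014).  USE (cell bsd-f1-sign2, crux C2): the SPLIT stratum `Δ_W ≡ 1 (mod 8)` of the cubic `2`-division fields (three dyadic primes, all
totally ramified in the cyclotomic `ℤ₂`-tower), where Chevalley's bound on ambiguous classes is `≥ 4` from layer `2` on and g49's two-prime cyclicity does not apply:
coinvariant cyclicity at layer `1` (Chevalley + one non-norm unit) now propagates to every layer, and the relation door fires.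

References: [Washington1997] L. C. Washington, *Introduction to Cyclotomic Fields*, 2nd ed., §13.3 Lemmas 13.15, 13.18, Prop. 13.22; [Gras2003] G. Gras, *Class Field
Theory*, IV.4; [NeukirchANT1999] J. Neukirch, *Algebraic Number Theory*, Ch. IV §6, Ch. VI §6 Prop. (6.9), §7 Thm. (7.1); [Cox2013] D. A. Cox, *Primes of the form
x² + ny²*, 2nd ed., §5.C, §8.A Thm. 8.10; [Lang1990] S. Lang, *Cyclotomic Fields I and II*, Ch. 13 §4.
-/

set_option autoImplicit false

noncomputable section

open scoped NumberField commutatorElement Pointwise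
open NumberField IsDedekindDomain Field IntermediateField

namespace Literature.NumberTheory.NumberFields

/-! ## §1 Group theory: the layer datum -/

section Group

variable {Γ : Type*} [Group Γ] [Finite Γ]

omit [Finite Γ] in
/-- A subgroup containing the commutator subgroup is normal. [folklore] -/
private theorem normal_of_commutator_le' {C : Subgroup Γ} (h : ⁅(⊤ : Subgroup Γ), (⊤ : Subgroup Γ)⁆ ≤ C) : C.Normal :=
  ⟨fun n hn g => by
    have h1 : g * n * g⁻¹ = ⁅g, n⁆ * n := by rw [commutatorElement_def]; group
    rw [h1]
    exact mul_mem (h (Subgroup.commutator_mem_commutator (Subgroup.mem_top g) (Subgroup.mem_top n))) hn⟩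

/-- `A ⊔ I = ⊤` when `I ∩ A = 1` and `#I = [Γ : A]`. [folklore] -/
private theorem sup_eq_top_of_inf_eq_bot_of_card {A I : Subgroup Γ} [A.Normal] (hIA : I ⊓ A = ⊥) (hcard : Nat.card I = A.index) :
    A ⊔ I = ⊤ := by
  rw [← Subgroup.index_eq_one, ← Nat.dvd_one]
  have h3 : A.relIndex (A ⊔ I) * (A ⊔ I).index = A.index := Subgroup.relIndex_mul_index le_sup_left
  have h4 : A.relIndex (A ⊔ I) = A.relIndex I := Subgroup.relIndex_sup_left (H := I) (K := A)
  have h5 : A.relIndex I = Nat.card I := by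
    rw [Subgroup.relIndex, show A.subgroupOf I = ⊥ from ?_, Subgroup.index_bot]
    rw [eq_bot_iff]
    intro x hx
    have : (x : Γ) ∈ I ⊓ A := ⟨x.2, hx⟩
    rw [hIA, Subgroup.mem_bot] at this
    exact Subtype.ext this
  rw [h4, h5, hcard] at h3
  have hpos : 0 < A.index := Nat.pos_of_ne_zero Subgroup.index_ne_zero_of_finite
  exact ⟨1, by nlinarith [h3]⟩

omit [Finite Γ] in
/-- In a cyclic subgroup `I` with `A ⊔ I = ⊤` and `A ≤ Γ₁`, `[Γ : Γ₁] = p` prime, `Γ₁` normal: every element of `I ∩ Γ₁` is a `p`-th power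
(`I ↠ Γ/Γ₁` of prime order, so `g^a ∈ Γ₁` forces `p ∣ a`). [folklore] -/
private theorem mem_closure_pow_of_mem_inf {p : ℕ} (hp : p.Prime) {A Γ₁ I : Subgroup Γ} [Γ₁.Normal] (hAΓ₁ : A ≤ Γ₁)
    (hΓ₁ : Γ₁.index = p) (hI : IsCyclic I) (hAI : A ⊔ I = ⊤) {x : Γ} (hx : x ∈ I ⊓ Γ₁) :
    x ∈ Subgroup.closure (Set.range fun g : Γ => g ^ p) := by
  classical
  obtain ⟨g₀, hg₀⟩ := IsCyclic.exists_generator (α := I)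
  set g : Γ := (g₀ : Γ) with hgdef
  -- `g ∉ Γ₁`: otherwise `I ≤ Γ₁`, `⊤ = A ⊔ I ≤ Γ₁`
  have hgΓ₁ : g ∉ Γ₁ := by
    intro hg
    have hIle : I ≤ Γ₁ := by
      intro y hy
      obtain ⟨k, hk⟩ := Subgroup.mem_zpowers_iff.mp (hg₀ ⟨y, hy⟩)
      have : y = g ^ k := by
        have := congrArg (fun t : I => (t : Γ)) hk
        simpa [hgdef] using this.symm
      rw [this]
      exact Γ₁.zpow_mem hg k
    have htop : (⊤ : Subgroup Γ) ≤ Γ₁ := by rw [← hAI]; exact sup_le hAΓ₁ hIle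
    have h1 : Γ₁.index = 1 := by rw [Subgroup.index_eq_one]; exact top_le_iff.mp htop
    rw [h1] at hΓ₁
    exact hp.one_lt.ne hΓ₁
  -- the image of `g` in `Γ/Γ₁` has order `p`
  have hord : orderOf (QuotientGroup.mk (s := Γ₁) g) = p := by
    have hdvd : orderOf (QuotientGroup.mk (s := Γ₁) g) ∣ p := by
      rw [← hΓ₁, Subgroup.index]
      exact orderOf_dvd_natCard _
    rcases (Nat.dvd_prime hp).mp hdvd with h | h
    · exfalso
      rw [orderOf_eq_one_iff, QuotientGroup.eq_one_iff] at h
      exact hgΓ₁ h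
    · exact h
  obtain ⟨hxI, hxΓ₁⟩ := Subgroup.mem_inf.mp hx
  obtain ⟨a, ha⟩ := Subgroup.mem_zpowers_iff.mp (hg₀ ⟨x, hxI⟩)
  have hxa : x = g ^ a := by
    have := congrArg (fun t : I => (t : Γ)) ha
    simpa [hgdef] using this.symm
  have hpa : (p : ℤ) ∣ a := by
    rw [← hord]
    refine orderOf_dvd_iff_zpow_eq_one.mpr ?_
    rw [← QuotientGroup.mk_zpow, ← hxa, QuotientGroup.eq_one_iff]
    exact hxΓ₁
  obtain ⟨b, rfl⟩ := hpa
  rw [hxa, mul_comm, zpow_mul, zpow_natCast]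
  exact Subgroup.subset_closure ⟨g ^ b, rfl⟩

/-- **The layer datum.**  `Γ` finite; `C ≤ A ≤ Γ₁ ≤ Γ` with `⁅Γ,Γ⁆ ≤ C`, `a^p ∈ C` for `a ∈ A`, `[Γ : Γ₁] = p`; `I₁ ≤ Γ` with `I₁ ∩ A = 1` and `#I₁ = [Γ : A]`.
THEN `[A : C] ≤ [Γ₁ : C·⟨g^p : g ∈ Γ⟩]` (with `B = C·(I₁ ∩ Γ₁)`: `C·⟨g^p⟩ ≤ B` and `B ∩ A = C`).
[cite: Washington1997, §13.3 Lemmas 13.15 and 13.18] [cite: Gras2003, IV.4 (genus theory)] -/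
theorem relIndex_le_relIndex_of_genus_layer_data {p : ℕ} (C A Γ₁ I₁ : Subgroup Γ)
    (hcomm : ⁅(⊤ : Subgroup Γ), (⊤ : Subgroup Γ)⁆ ≤ C) (hCA : C ≤ A) (hAΓ₁ : A ≤ Γ₁) (hΓ₁ : Γ₁.index = p)
    (hexp : ∀ a ∈ A, a ^ p ∈ C) (hI₁A : I₁ ⊓ A = ⊥) (hcard₁ : Nat.card I₁ = A.index) :
    C.relIndex A ≤ (C ⊔ Subgroup.closure (Set.range fun g : Γ => g ^ p)).relIndex Γ₁ := by
  classical
  haveI hCn : C.Normal := normal_of_commutator_le' hcomm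
  haveI hAn : A.Normal := normal_of_commutator_le' (hcomm.trans hCA)
  haveI hΓ₁n : Γ₁.Normal := normal_of_commutator_le' ((hcomm.trans hCA).trans hAΓ₁)
  have hAI : A ⊔ I₁ = ⊤ := sup_eq_top_of_inf_eq_bot_of_card hI₁A hcard₁
  set B : Subgroup Γ := C ⊔ (I₁ ⊓ Γ₁) with hB
  haveI hBn : B.Normal := normal_of_commutator_le' (hcomm.trans le_sup_left)
  set P : Subgroup Γ := C ⊔ Subgroup.closure (Set.range fun g : Γ => g ^ p) with hPdef
  -- every `p`-th power lies in `Γ₁`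
  have hpowΓ₁ : ∀ g : Γ, g ^ p ∈ Γ₁ := by
    intro g
    rw [← QuotientGroup.eq_one_iff, QuotientGroup.mk_pow]
    have hdvd : orderOf (QuotientGroup.mk (s := Γ₁) g) ∣ p := by
      rw [← hΓ₁, Subgroup.index]
      exact orderOf_dvd_natCard _
    exact orderOf_dvd_iff_pow_eq_one.mp hdvd
  -- `Γ/B` is commutative
  haveI hQc : IsMulCommutative (Γ ⧸ B) := by
    rw [Subgroup.Normal.quotient_commutative_iff_commutator_le, commutator_def]
    exact hcomm.trans le_sup_left
  -- `P ≤ B`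
  have hPB : P ≤ B := by
    refine sup_le le_sup_left ((Subgroup.closure_le _).mpr ?_)
    rintro _ ⟨g, rfl⟩
    have hg : g ∈ A ⊔ I₁ := by rw [hAI]; exact Subgroup.mem_top g
    rw [Subgroup.mem_sup_of_normal_left] at hg
    obtain ⟨a, ha, i, hi, rfl⟩ := hg
    have hc : Commute (QuotientGroup.mk (s := B) a) (QuotientGroup.mk (s := B) i) := hQc.is_comm.comm _ _
    rw [SetLike.mem_coe, ← QuotientGroup.eq_one_iff, QuotientGroup.mk_pow, QuotientGroup.mk_mul, hc.mul_pow,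
      ← QuotientGroup.mk_pow, ← QuotientGroup.mk_pow, (QuotientGroup.eq_one_iff _).mpr (Subgroup.mem_sup_left (hexp a ha) : a ^ p ∈ B),
      one_mul, QuotientGroup.eq_one_iff]
    exact Subgroup.mem_sup_right ⟨I₁.pow_mem hi p, hpowΓ₁ i⟩
  -- `B ∩ A = C`
  have hBA : B ⊓ A = C := by
    refine le_antisymm ?_ (le_inf le_sup_left hCA)
    intro x hx
    obtain ⟨hxB, hxA⟩ := Subgroup.mem_inf.mp hx
    rw [hB, Subgroup.mem_sup_of_normal_left] at hxB
    obtain ⟨c, hc, i, hi, rfl⟩ := hxB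
    have hiA : i ∈ A := by
      have : c⁻¹ * (c * i) ∈ A := mul_mem (inv_mem (hCA hc)) hxA
      simpa using this
    have hi1 : i ∈ I₁ ⊓ A := ⟨hi.1, hiA⟩
    rw [hI₁A, Subgroup.mem_bot] at hi1
    rw [hi1, mul_one]
    exact hc
  -- `[A : C] = [A : A ∩ B] ≤ [Γ₁ : B] ≤ [Γ₁ : P]`
  have h1 : C.relIndex A = B.relIndex A := by rw [← hBA, Subgroup.inf_relIndex_right]
  have hne1 : B.relIndex Γ₁ ≠ 0 := Subgroup.index_ne_zero_of_finite (H := B.subgroupOf Γ₁)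
  have hne2 : P.relIndex Γ₁ ≠ 0 := Subgroup.index_ne_zero_of_finite (H := P.subgroupOf Γ₁)
  have h2 : B.relIndex A ≤ B.relIndex Γ₁ := Subgroup.relIndex_le_of_le_right hAΓ₁ hne1
  have h3 : B.relIndex Γ₁ ≤ P.relIndex Γ₁ := Subgroup.relIndex_le_of_le_left hPB hne2
  rw [h1]
  exact h2.trans h3

end Group

/-! ## §1b Inertia groups along a homomorphism of Galois groups -/

section Inertia

variable {H : Type*} [Field H] {Γ Γ' : Type*} [Group Γ] [Group Γ'] [MulSemiringAction Γ H] [MulSemiringAction Γ' H]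

/-- For `f : Γ → Γ'` compatible with the actions on `𝓞 H`, `f(I_Γ(Q)) ≤ I_{Γ'}(Q)`. [folklore] -/
private theorem map_inertia_le (Q : Ideal (𝓞 H)) (f : Γ →* Γ') (hf : ∀ (γ : Γ) (x : 𝓞 H), f γ • x = γ • x) :
    (Q.inertia Γ).map f ≤ Q.inertia Γ' := by
  rintro _ ⟨γ, hγ, rfl⟩
  intro x
  rw [hf]
  exact hγ x

/-- For `f : Γ ↪ Γ'` compatible with the actions on `𝓞 H`, `#I_Γ(Q) = #(I_{Γ'}(Q) ⊓ f(Γ))`. [folklore] -/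
private theorem card_inertia_eq_card_inf_range'' (Q : Ideal (𝓞 H)) (f : Γ →* Γ') (hinj : Function.Injective f)
    (hf : ∀ (γ : Γ) (x : 𝓞 H), f γ • x = γ • x) :
    Nat.card (Q.inertia Γ) = Nat.card (Q.inertia Γ' ⊓ f.range : Subgroup Γ') := by
  refine Nat.card_congr (Equiv.ofBijective
    (fun γ => ⟨f γ, fun x => by rw [hf]; exact γ.2 x, γ.1, rfl⟩) ⟨?_, ?_⟩)
  · intro a b h
    exact Subtype.ext (hinj (congrArg (fun t : ↥(Q.inertia Γ' ⊓ f.range) => (t : Γ')) h))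
  · rintro ⟨g, hgI, γ, rfl⟩
    exact ⟨⟨γ, fun x => by rw [← hf]; exact hgI x⟩, rfl⟩

end Inertia

/-! ## §2 The theorem -/

section Main

variable {K L : Type} [Field K] [NumberField K] [Field L] [NumberField L] [Algebra K L] [IsGalois K L]
  [IsUnramifiedAtInfinitePlaces K L]
  (M : Type) [Field M] [NumberField M] [Algebra K M] [Algebra M L] [IsScalarTower K M L] [IsGalois K M]

set_option maxHeartbeats 3200000 in
set_option synthInstance.maxHeartbeats 400000 in
/-- ★★★ **GENUS COINVARIANTS ARE READ AT THE FIRST LAYER.**  `L/K` Galois with CYCLIC group, unramified at the infinite places; `M/K` an intermediate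
Galois extension of prime degree `p`; a maximal ideal `P₁ ⊂ 𝓞_K` above which every maximal ideal of `𝓞_L` has ramification index `[L:K]`; every maximal ideal of
`𝓞_L` with ramification index `1` or `[L:K]` over `K` (every ramified prime TOTALLY ramified).  THEN
**`[Cl(𝓞 L) : Cl(𝓞 L)^p · ⟨σc·c⁻¹ : σ ∈ Gal(L/K), c⟩] ≤ [Cl(𝓞 M) : Cl(𝓞 M)^p · ⟨σc·c⁻¹ : σ ∈ Gal(M/K), c⟩]`** — the order of the
`Gal`-coinvariants of `Cl/p` does not grow above the first layer (any number of ramified primes, any class number of `K`).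
[cite: Washington1997, §13.3 Lemmas 13.15, 13.18 and Prop. 13.22] [cite: Gras2003, IV.4 (genus theory)] [cite: NeukirchANT1999, Ch. VI §7 Thm. (7.1), §6 Prop. (6.9)]
[cite: Cox2013, §8.A Thm. 8.10] -/
theorem index_pow_sup_closure_le_of_layer_one {p : ℕ} [hp : Fact p.Prime] (hcyc : IsCyclic (L ≃ₐ[K] L))
    (hM : Module.finrank K M = p) (P₁ : Ideal (𝓞 K)) [P₁.IsMaximal]
    (htot₁ : ∀ (q : Ideal (𝓞 L)) [q.IsMaximal], q.under (𝓞 K) = P₁ → q.ramificationIdx (𝓞 K) = Module.finrank K L)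
    (htot : ∀ (q : Ideal (𝓞 L)) [q.IsMaximal], q.ramificationIdx (𝓞 K) = 1 ∨ q.ramificationIdx (𝓞 K) = Module.finrank K L) :
    ((powMonoidHom p : ClassGroup (𝓞 L) →* ClassGroup (𝓞 L)).range ⊔
      Subgroup.closure {x | ∃ (σ : L ≃ₐ[K] L) (c : ClassGroup (𝓞 L)),
        x = ClassGroup.mulEquiv (AmbiguousClass.intAut σ) c * c⁻¹}).index ≤
    ((powMonoidHom p : ClassGroup (𝓞 M) →* ClassGroup (𝓞 M)).range ⊔
      Subgroup.closure {x | ∃ (σ : M ≃ₐ[K] M) (c : ClassGroup (𝓞 M)),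
        x = ClassGroup.mulEquiv (AmbiguousClass.intAut σ) c * c⁻¹}).index := by
  classical
  -- ### §0 the Hilbert class field `H` of `L`, Galois over `K`; `ρ : Gal(H/L) → Gal(H/K)`
  haveI : IsScalarTower K L (hilbertClassField L) :=
    IsScalarTower.of_algebraMap_eq fun x => Subtype.ext (IsScalarTower.algebraMap_apply K L (AlgebraicClosure L) x)
  haveI : IsScalarTower M L (hilbertClassField L) :=
    IsScalarTower.of_algebraMap_eq fun x => Subtype.ext (IsScalarTower.algebraMap_apply M L (AlgebraicClosure L) x)
  haveI : IsScalarTower K M (hilbertClassField L) :=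
    IsScalarTower.of_algebraMap_eq fun x => by
      rw [IsScalarTower.algebraMap_apply K L (hilbertClassField L) x, IsScalarTower.algebraMap_apply K M L x,
        ← IsScalarTower.algebraMap_apply M L (hilbertClassField L)]
  haveI : IsGalois K (hilbertClassField L) := hilbertClassField.isGalois_of_isGalois L
  haveI : IsUnramifiedAtInfinitePlaces K (hilbertClassField L) :=
    IsUnramifiedAtInfinitePlaces.trans K L (hilbertClassField L)
  haveI : FiniteDimensional K (hilbertClassField L) := Module.Finite.of_restrictScalars_finite ℚ K (hilbertClassField L)
  haveI : FiniteDimensional M (hilbertClassField L) := Module.Finite.of_restrictScalars_finite K M (hilbertClassField L)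
  haveI : IsGalois M (hilbertClassField L) := IsGalois.tower_top_of_isGalois K M (hilbertClassField L)
  haveI : IsUnramifiedAtInfinitePlaces M (hilbertClassField L) := IsUnramifiedAtInfinitePlaces.top K M (hilbertClassField L)
  let ρ : (hilbertClassField L ≃ₐ[L] hilbertClassField L) →* (hilbertClassField L ≃ₐ[K] hilbertClassField L) :=
    { toFun := fun a => a.restrictScalars K
      map_one' := rfl
      map_mul' := fun _ _ => rfl }
  have hρ : ∀ a y, ρ a y = a y := fun _ _ => rfl
  have hρinj : Function.Injective ρ := fun a b h => AlgEquiv.restrictScalars_injective K h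
  let ρM : (hilbertClassField L ≃ₐ[M] hilbertClassField L) →* (hilbertClassField L ≃ₐ[K] hilbertClassField L) :=
    { toFun := fun a => a.restrictScalars K
      map_one' := rfl
      map_mul' := fun _ _ => rfl }
  have hρM : ∀ a y, ρM a y = a y := fun _ _ => rfl
  -- the restriction `π : Gal(H/K) → Gal(L/K)` and its kernel `A = ρ(Gal(H/L))`
  set π : (hilbertClassField L ≃ₐ[K] hilbertClassField L) →* (L ≃ₐ[K] L) := AlgEquiv.restrictNormalHom L with hπ
  have hπ_apply : ∀ (τ : hilbertClassField L ≃ₐ[K] hilbertClassField L) (x : L),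
      algebraMap L (hilbertClassField L) (π τ x) = τ (algebraMap L (hilbertClassField L) x) := fun τ x =>
    AlgEquiv.restrictNormal_commutes τ L x
  set A : Subgroup (hilbertClassField L ≃ₐ[K] hilbertClassField L) := ρ.range with hA
  have hkerπ : π.ker = A := by
    ext τ
    rw [MonoidHom.mem_ker]
    constructor
    · intro h1
      have hfix : ∀ x : L, τ (algebraMap L (hilbertClassField L) x) = algebraMap L (hilbertClassField L) x := fun x => by
        rw [← hπ_apply, h1, AlgEquiv.one_apply]
      exact ⟨AlgEquiv.ofRingEquiv (f := τ.toRingEquiv) hfix, AlgEquiv.ext fun y => rfl⟩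
    · rintro ⟨a, rfl⟩
      apply AlgEquiv.ext
      intro x
      apply (algebraMap L (hilbertClassField L)).injective
      rw [hπ_apply, hρ, AlgEquiv.commutes, AlgEquiv.one_apply]
  have hπsurj : Function.Surjective π := AlgEquiv.restrictNormalHom_surjective (hilbertClassField L)
  haveI hAn : A.Normal := by rw [← hkerπ]; infer_instance
  have hAidx : A.index = Module.finrank K L := by
    rw [← hkerπ, Subgroup.index_ker, MonoidHom.range_eq_top.mpr hπsurj, Subgroup.card_top, IsGalois.card_aut_eq_finrank]
  haveI : IsCyclic ((hilbertClassField L ≃ₐ[K] hilbertClassField L) ⧸ π.ker) :=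
    isCyclic_of_surjective _ (QuotientGroup.quotientKerEquivOfSurjective π hπsurj).symm.surjective
  haveI : IsCyclic ((hilbertClassField L ≃ₐ[K] hilbertClassField L) ⧸ A) :=
    isCyclic_of_surjective _ (QuotientGroup.quotientMulEquivOfEq hkerπ).surjective
  -- the restriction `πM : Gal(H/K) → Gal(M/K)` and its kernel `Γ₁ = ρM(Gal(H/M))`, of index `p`
  set πM : (hilbertClassField L ≃ₐ[K] hilbertClassField L) →* (M ≃ₐ[K] M) := AlgEquiv.restrictNormalHom M with hπM
  have hπM_apply : ∀ (τ : hilbertClassField L ≃ₐ[K] hilbertClassField L) (x : M),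
      algebraMap M (hilbertClassField L) (πM τ x) = τ (algebraMap M (hilbertClassField L) x) := fun τ x =>
    AlgEquiv.restrictNormal_commutes τ M x
  set Γ₁ : Subgroup (hilbertClassField L ≃ₐ[K] hilbertClassField L) := ρM.range with hΓ₁
  have hkerπM : πM.ker = Γ₁ := by
    ext τ
    rw [MonoidHom.mem_ker]
    constructor
    · intro h1
      have hfix : ∀ x : M, τ (algebraMap M (hilbertClassField L) x) = algebraMap M (hilbertClassField L) x := fun x => by
        rw [← hπM_apply, h1, AlgEquiv.one_apply]
      exact ⟨AlgEquiv.ofRingEquiv (f := τ.toRingEquiv) hfix, AlgEquiv.ext fun y => rfl⟩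
    · rintro ⟨a, rfl⟩
      apply AlgEquiv.ext
      intro x
      apply (algebraMap M (hilbertClassField L)).injective
      rw [hπM_apply, hρM, AlgEquiv.commutes, AlgEquiv.one_apply]
  have hπMsurj : Function.Surjective πM := AlgEquiv.restrictNormalHom_surjective (hilbertClassField L)
  have hΓ₁idx : Γ₁.index = p := by
    rw [← hkerπM, Subgroup.index_ker, MonoidHom.range_eq_top.mpr hπMsurj, Subgroup.card_top, IsGalois.card_aut_eq_finrank, hM]
  have hAΓ₁ : A ≤ Γ₁ := by
    rintro _ ⟨a, rfl⟩
    exact ⟨a.restrictScalars M, AlgEquiv.ext fun _ => rfl⟩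
  -- ### §1 `S = Cl^p·⟨σc·c⁻¹⟩`, `C = Artin(S) ≤ Gal(H/L)`, `Ct = ρ(C)`
  set S : Subgroup (ClassGroup (𝓞 L)) := (powMonoidHom p : ClassGroup (𝓞 L) →* ClassGroup (𝓞 L)).range ⊔
      Subgroup.closure {x | ∃ (σ : L ≃ₐ[K] L) (c : ClassGroup (𝓞 L)), x = ClassGroup.mulEquiv (AmbiguousClass.intAut σ) c * c⁻¹} with hS
  have hSσ : ∀ (σ : L ≃ₐ[K] L) (c : ClassGroup (𝓞 L)), ClassGroup.mulEquiv (AmbiguousClass.intAut σ) c * c⁻¹ ∈ S := fun σ c =>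
    Subgroup.mem_sup_right (Subgroup.subset_closure ⟨σ, c, rfl⟩)
  have hSp : ∀ c : ClassGroup (𝓞 L), c ^ p ∈ S := fun c => Subgroup.mem_sup_left ⟨c, rfl⟩
  set C : Subgroup (hilbertClassField L ≃ₐ[L] hilbertClassField L) := S.map (hilbertClassField.artinEquiv L).toMonoidHom with hC
  set Ct : Subgroup (hilbertClassField L ≃ₐ[K] hilbertClassField L) := C.map ρ with hCt
  have hCtA : Ct ≤ A := Subgroup.map_le_range ρ C
  have hmemCt : ∀ c : ClassGroup (𝓞 L), c ∈ S → ρ (hilbertClassField.artinEquiv L c) ∈ Ct := fun c hc =>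
    ⟨_, ⟨c, hc, rfl⟩, rfl⟩
  -- `[A : Ct] = [Cl : S]`
  have hrel : Ct.relIndex A = S.index := by
    have h1 : Ct.comap ρ = C := by rw [hCt]; exact Subgroup.comap_map_eq_self_of_injective hρinj C
    have h2 : (Ct.comap ρ).index = Ct.relIndex ρ.range := Subgroup.index_comap Ct ρ
    rw [hA, ← h2, h1, hC]
    refine Subgroup.index_map_eq S (hilbertClassField.artinEquiv L).surjective ?_
    intro x hx
    rw [MonoidHom.mem_ker] at hx
    have : x = 1 := (hilbertClassField.artinEquiv L).injective (by rw [map_one]; exact hx)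
    rw [this]
    exact one_mem S
  have hexpA : ∀ a ∈ A, a ^ p ∈ Ct := by
    rintro _ ⟨b, rfl⟩
    set c : ClassGroup (𝓞 L) := (hilbertClassField.artinEquiv L).symm b with hcdef
    have hc : hilbertClassField.artinEquiv L c = b := (hilbertClassField.artinEquiv L).apply_symm_apply b
    rw [← map_pow, ← hc, ← map_pow]
    exact hmemCt _ (hSp c)
  -- ### §2 `⁅Γ, A⁆ ≤ Ct` (equivariant Artin) and `⁅Γ, Γ⁆ ≤ Ct`
  have hcommA : ⁅(⊤ : Subgroup (hilbertClassField L ≃ₐ[K] hilbertClassField L)), A⁆ ≤ Ct := by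
    rw [Subgroup.commutator_le]
    intro τ _ b hb
    obtain ⟨a, rfl⟩ := MonoidHom.mem_range.mp hb
    have hτ : ∀ x : L, τ (algebraMap L (hilbertClassField L) x) =
        algebraMap L (hilbertClassField L) (τ.restrictNormal L x) := fun x => (AlgEquiv.restrictNormal_commutes τ L x).symm
    obtain ⟨a', ha'⟩ := hilbertClassField.exists_algEquiv_conj L τ (τ.restrictNormal L) hτ a
    set c : ClassGroup (𝓞 L) := (hilbertClassField.artinEquiv L).symm a with hcdef
    have hc : hilbertClassField.artinEquiv L c = a := (hilbertClassField.artinEquiv L).apply_symm_apply a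
    have key : hilbertClassField.artinEquiv L (ClassGroup.mulEquiv (AmbiguousClass.intAut (τ.restrictNormal L)) c) = a' :=
      AlgEquiv.ext fun y => (hilbertClassField.artinEquiv_mulEquiv_intAut_apply L τ (τ.restrictNormal L) hτ c y).trans
        (by rw [hc, ha'])
    have hconj : τ * ρ a * τ⁻¹ = ρ a' := by
      apply AlgEquiv.ext
      intro y
      rw [AlgEquiv.mul_apply, AlgEquiv.mul_apply, hρ, hρ, ha']
      rfl
    have hcomm : ⁅τ, ρ a⁆ = ρ (a' * a⁻¹) := by
      rw [commutatorElement_def, hconj, map_mul, map_inv]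
    rw [hcomm, ← key, ← hc, ← map_inv, ← map_mul]
    exact hmemCt _ (hSσ _ _)
  haveI hCtn : Ct.Normal := ⟨fun x hx g => by
    have h1 : g * x * g⁻¹ = ⁅g, x⁆ * x := by rw [commutatorElement_def]; group
    rw [h1]
    exact mul_mem (hcommA (Subgroup.commutator_mem_commutator (Subgroup.mem_top g) (hCtA hx))) hx⟩
  -- `Γ/Ct` is commutative: `A/Ct` is central (by `hcommA`) with cyclic quotient `Γ/A ≅ Gal(L/K)`
  have hQcomm : ∀ a b : (hilbertClassField L ≃ₐ[K] hilbertClassField L) ⧸ Ct, a * b = b * a := by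
    have hle : Ct ≤ π.ker := by rw [hkerπ]; exact hCtA
    let f : ((hilbertClassField L ≃ₐ[K] hilbertClassField L) ⧸ Ct) →* (L ≃ₐ[K] L) := QuotientGroup.lift Ct π hle
    have hf : f.ker ≤ Subgroup.center _ := by
      intro x hx
      induction x using QuotientGroup.induction_on with
      | H g =>
        rw [MonoidHom.mem_ker, QuotientGroup.lift_mk] at hx
        have hgA : g ∈ A := by rw [← hkerπ]; exact hx
        rw [Subgroup.mem_center_iff]
        intro y
        induction y using QuotientGroup.induction_on with
        | H h =>
          rw [← QuotientGroup.mk_mul, ← QuotientGroup.mk_mul, QuotientGroup.eq]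
          have h2 : (h * g)⁻¹ * (g * h) = ⁅g⁻¹, h⁻¹⁆ := by rw [commutatorElement_def]; group
          rw [h2, ← commutatorElement_inv]
          exact inv_mem (hcommA (Subgroup.commutator_mem_commutator (Subgroup.mem_top _) (inv_mem hgA)))
    haveI : IsCyclic (L ≃ₐ[K] L) := hcyc
    exact (f.isMulCommutative_of_isCyclic_of_ker_le_center hf).is_comm.comm
  haveI hQc : IsMulCommutative ((hilbertClassField L ≃ₐ[K] hilbertClassField L) ⧸ Ct) := ⟨⟨hQcomm⟩⟩
  have hcommTop : ⁅(⊤ : Subgroup (hilbertClassField L ≃ₐ[K] hilbertClassField L)), ⊤⁆ ≤ Ct := by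
    rw [← commutator_def, ← Subgroup.Normal.quotient_commutative_iff_commutator_le]
    exact hQc
  -- ### §3 inertia groups meet `A` trivially (`H/L` is unramified); their order is the ramification index below
  have hIA : ∀ (𝔔 : Ideal (𝓞 (hilbertClassField L))) [𝔔.IsMaximal],
      𝔔.inertia (hilbertClassField L ≃ₐ[K] hilbertClassField L) ⊓ A = ⊥ := by
    intro 𝔔 _
    have hcardL : Nat.card (𝔔.inertia (hilbertClassField L ≃ₐ[L] hilbertClassField L)) = 1 := by
      rw [card_inertia_eq_ramificationIdx (hilbertClassField L) (hilbertClassField L ≃ₐ[L] hilbertClassField L) L 𝔔]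
      haveI := hilbertClassField.isUnramifiedAt L 𝔔
      exact Ideal.ramificationIdx_eq_one 𝔔 (𝓞 L)
    have hcmp := card_inertia_eq_card_inf_range'' 𝔔 ρ hρinj (fun _ _ => rfl)
    rw [hcardL] at hcmp
    rw [hA]
    exact Subgroup.card_eq_one.mp hcmp.symm
  have htower : ∀ (𝔔 : Ideal (𝓞 (hilbertClassField L))) [𝔔.IsMaximal],
      Nat.card (𝔔.inertia (hilbertClassField L ≃ₐ[K] hilbertClassField L)) = (𝔔.under (𝓞 L)).ramificationIdx (𝓞 K) := by
    intro 𝔔 _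
    haveI : (𝔔.under (𝓞 L)).IsMaximal := Ideal.IsMaximal.under (𝓞 L) 𝔔
    have ht := Ideal.ramificationIdx_tower (R := 𝓞 K) (𝔔.under (𝓞 L)) 𝔔
    haveI := hilbertClassField.isUnramifiedAt L 𝔔
    rw [Ideal.ramificationIdx_eq_one 𝔔 (𝓞 L), mul_one] at ht
    rw [card_inertia_eq_ramificationIdx (hilbertClassField L) (hilbertClassField L ≃ₐ[K] hilbertClassField L) K 𝔔, ht]
  -- an inertia group of `H/K` is cyclic (it embeds in `Γ/A`)
  have hIcyc : ∀ (𝔔 : Ideal (𝓞 (hilbertClassField L))) [𝔔.IsMaximal],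
      IsCyclic (𝔔.inertia (hilbertClassField L ≃ₐ[K] hilbertClassField L)) := by
    intro 𝔔 _
    set I := 𝔔.inertia (hilbertClassField L ≃ₐ[K] hilbertClassField L) with hI
    let j₂ : I →* (hilbertClassField L ≃ₐ[K] hilbertClassField L) ⧸ A := (QuotientGroup.mk' A).comp I.subtype
    have hj : Function.Injective j₂ := by
      intro x y hxy
      have h1 : (QuotientGroup.mk (s := A) ((x : I) : hilbertClassField L ≃ₐ[K] hilbertClassField L)) =
          QuotientGroup.mk (s := A) ((y : I) : hilbertClassField L ≃ₐ[K] hilbertClassField L) := hxy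
      rw [QuotientGroup.eq] at h1
      have h2 : ((x : hilbertClassField L ≃ₐ[K] hilbertClassField L))⁻¹ * y ∈ I ⊓ A :=
        Subgroup.mem_inf.mpr ⟨I.mul_mem (I.inv_mem x.2) y.2, h1⟩
      rw [hIA 𝔔, Subgroup.mem_bot] at h2
      exact Subtype.ext (inv_mul_eq_one.mp h2)
    exact isCyclic_of_surjective (MonoidHom.ofInjective hj).symm.toMonoidHom (MonoidHom.ofInjective hj).symm.surjective
  -- ### §4 the layer-one input: `[Γ₁ : P] ∣ [Cl(M) : Cl^p·⟨σc·c⁻¹⟩]` with `P = Ct·⟨g^p⟩`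
  set P : Subgroup (hilbertClassField L ≃ₐ[K] hilbertClassField L) :=
    Ct ⊔ Subgroup.closure (Set.range fun g : hilbertClassField L ≃ₐ[K] hilbertClassField L => g ^ p) with hPdef
  set N : Subgroup (hilbertClassField L ≃ₐ[M] hilbertClassField L) := P.comap ρM with hN
  haveI hΓ₁n : Γ₁.Normal := by rw [← hkerπM]; infer_instance
  have hcommN : ⁅(⊤ : Subgroup (hilbertClassField L ≃ₐ[M] hilbertClassField L)), ⊤⁆ ≤ N := by
    rw [hN, ← Subgroup.map_le_iff_le_comap, Subgroup.map_commutator]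
    exact (Subgroup.commutator_mono le_top le_top).trans (hcommTop.trans le_sup_left)
  have hIN : ∀ (Q : Ideal (𝓞 (hilbertClassField L))) [Q.IsMaximal], Q.inertia (hilbertClassField L ≃ₐ[M] hilbertClassField L) ≤ N := by
    intro Q _
    rw [hN, ← Subgroup.map_le_iff_le_comap]
    have hle : (Q.inertia (hilbertClassField L ≃ₐ[M] hilbertClassField L)).map ρM ≤
        Q.inertia (hilbertClassField L ≃ₐ[K] hilbertClassField L) ⊓ Γ₁ :=
      le_inf (map_inertia_le Q ρM (fun _ _ => rfl)) (Subgroup.map_le_range ρM _)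
    refine hle.trans ?_
    set I := Q.inertia (hilbertClassField L ≃ₐ[K] hilbertClassField L) with hI
    haveI : (Q.under (𝓞 L)).IsMaximal := Ideal.IsMaximal.under (𝓞 L) Q
    rcases htot (Q.under (𝓞 L)) with h1 | h1
    · -- unramified below: trivial inertia
      have hcard : Nat.card I = 1 := by rw [hI, htower, h1]
      rw [Subgroup.card_eq_one.mp hcard]
      exact inf_le_left.trans bot_le
    · -- totally ramified below: `#I = [Γ : A]`, so `A ⊔ I = ⊤` and `I ∩ Γ₁ ⊆ ⟨g^p⟩`
      have hcard : Nat.card I = A.index := by rw [hI, htower, h1, hAidx]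
      have hAI : A ⊔ I = ⊤ := sup_eq_top_of_inf_eq_bot_of_card (hIA Q) hcard
      intro x hx
      exact Subgroup.mem_sup_right (mem_closure_pow_of_mem_inf hp.out hAΓ₁ hΓ₁idx (hIcyc Q) hAI hx)
  have hdvd := index_sup_pow_sup_comap_commutator_dvd K M (hilbertClassField L) p N hcommN hIN ρM hρM
  have hEq : (N ⊔ Subgroup.closure (Set.range fun σ : hilbertClassField L ≃ₐ[M] hilbertClassField L => σ ^ p)) ⊔
      (⁅(⊤ : Subgroup (hilbertClassField L ≃ₐ[K] hilbertClassField L)), ρM.range⁆).comap ρM = N := by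
    refine le_antisymm (sup_le (sup_le le_rfl ?_) ?_) (le_sup_left.trans le_sup_left)
    · rw [Subgroup.closure_le]
      rintro _ ⟨σ, rfl⟩
      change ρM (σ ^ p) ∈ P
      rw [map_pow]
      exact Subgroup.mem_sup_right (Subgroup.subset_closure ⟨ρM σ, rfl⟩)
    · rw [hN]
      exact Subgroup.comap_mono ((Subgroup.commutator_mono le_rfl le_top).trans (hcommTop.trans le_sup_left))
  rw [hEq] at hdvd
  have hNidx : N.index = P.relIndex Γ₁ := by rw [hN, hΓ₁]; exact Subgroup.index_comap P ρM
  -- ### §5 one totally ramified prime, and the group lemma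
  obtain ⟨𝔔₁, h𝔔₁max, h𝔔₁⟩ := Ideal.exists_maximal_ideal_liesOver_of_isIntegral (S := 𝓞 (hilbertClassField L)) P₁
  haveI := h𝔔₁max
  haveI := h𝔔₁
  set I₁ := 𝔔₁.inertia (hilbertClassField L ≃ₐ[K] hilbertClassField L) with hI₁
  have hcard₁ : Nat.card I₁ = A.index := by
    haveI : (𝔔₁.under (𝓞 L)).IsMaximal := Ideal.IsMaximal.under (𝓞 L) 𝔔₁
    have hu : (𝔔₁.under (𝓞 L)).under (𝓞 K) = P₁ := by rw [Ideal.under_under]; exact h𝔔₁.over.symm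
    rw [hI₁, htower, htot₁ _ hu, hAidx]
  have hgroup := relIndex_le_relIndex_of_genus_layer_data Ct A Γ₁ I₁ hcommTop hCtA hAΓ₁ hΓ₁idx hexpA (hIA 𝔔₁) hcard₁
  -- ### §6 conclusion
  rw [hrel] at hgroup
  refine hgroup.trans ?_
  rw [← hNidx]
  exact Nat.le_of_dvd (Nat.pos_of_ne_zero Subgroup.index_ne_zero_of_finite) hdvd

end Main

end Literature.NumberTheory.NumberFields

end
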